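import Mathlib
import Literature.MathematicalPhysics.QuantumFieldTheory.Balaban1983to89.B2Sect2Statements
import Literature.MathematicalPhysics.QuantumFieldTheory.Balaban1983to89.B2Restr216Lattice

/-!
# `Balaban1983to89.B2Restr216Concrete` — T. Bałaban, *(Higgs)₂,₃ quantum fields in a finite volume. II. An upper
# bound*, Commun. Math. Phys. **86** (1982) 555–594 [Balaban1982Higgs2]: the small-field consequences (2.16)–(2.17)
# p. 560 PROVED for the concrete lattice Higgs model (Phase-2 row B2.Eq2.17, kind «model-instance»; file 2/2)

statement-level skeleton of published theorems with citation tags; proofs where landed; nothing here is a claim about the Yang–Mills mass gap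

PDF held: `paper:balaban1982-cmp86-higgs23-ii` (journal page = PDF page + 554); the proof follows the printed derivation
pp. 559–560, read from the ×2 renders `…/pages/1982-cmp86-higgs23-II/…-p005-x2.png`, `…-p006-x2.png` (cell `pub-balaban`).

WHAT IS REPRODUCED.  SKELETON row B2.Eq2.17 (decl of record `B2Sect2Statements.Restr216Printed` over r02's carrier
`R216Setting`) — the six bounds (2.16)–(2.17) with the printed constants 2Ldp, (2/λ^{1/4})p, 3Ldp, 2Ldp, (2/μ₀ε)p,
3Ldp — PROVED (`restr216Printed_setting216`) for the CONCRETE MODEL INSTANCE `setting216`: the first renormalization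
step of Sect. 2.A (*"We rescale it from ε-lattice T_ε to 1-lattice T₁"*, p. 556) over the typer's carriers
`…HiggsLattice`/`…HiggsAveraging` — T₁ = `Site P 0`, T′₁ = `Site P 1`, corner blocks B(y) of (I.1.17)
(`HiggsLattice.block`), staircase contours Γ_{y,x} of (I.2.1) and transports U(A(Γ_{y,x})) = `HiggsAveraging.holQ`
(U(A) = exp(qηeA), `ChargeData.U`), (Q(A)φ)(y) = L^{−d}Σ_{x∈B(y)}U(A(Γ_{y,x}))φ(x) = `HiggsAveraging.avgQ` (I (2.7)), the
unit-lattice covariant derivative (D_Aφ)(b) = U(A_b)φ(b₊) − φ(b₋) of (2.1) (`B2Restr216Lattice.covDiff`), a T′₁-bond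
⟨y, y′⟩ transported along the straight contour of L bonds of T₁ ((I.2.3); `bondHol`), and for the vector fields the plain
block average (QA)(y) = L^{−d}Σ_{x∈B(y)}A(x) and unit difference (∂A)(b) = A(b₊) − A(b₋) of (2.1)/(I.3.7) (`avgPlain`,
`vecAt`) — I p. 608: *"The renormalization transformations for vector fields will be obtained by taking N = d and an
external vector field A = 0"*, which is literally how (2.17) is obtained from the (2.16) lemmas here (`avgQ_zeroField`).
The region: Λ = Λ′₋₁ ⊂ T′₁ (blocks), its points B(Λ′₋₁) (`HiggsLattice.blockSet`), its bonds = the bonds of T₁ with both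
endpoints in B(Λ′₋₁) (p. 557: *"Λ* the set of all bonds contained in Λ, i.e. with endpoints belonging to Λ"*), its
T′₁-bonds ⟨y, y + e_μ⟩ with both endpoints in Λ; `restrSmall` = the six small-field restrictions (negations of (2.2)) on
these; the six `sup…` fields are the suprema (`⨆`; = 0 over an empty range) over exactly the printed ranges x ∈ B(y),
y ∈ Λ′₋₁, ⟨y, y′⟩ ∈ Λ′*₋₁.  PRINTED ARGUMENT ↦ LEAN: the telescoping along contours is file 1/2 `…B2Restr216Lattice`
(r14's `B2LargeField.norm_transport_sub_le_mul` instantiated); |(Q(A)φ)(y) − φ(y)| ≤ (L − 1)dp is r14's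
`B2LargeField.norm_blockAvg_sub_le` with |B(y)| = L^d; |ψ(y) − φ(y)| ≤ Ldp, |ψ(y) − U(A(Γ_{y,x}))φ(x)| ≤ 2Ldp are r14's
`display216a`/`display216b`; |ψ(y)| ≤ λ^{−1/4}p + p ≤ 2λ^{−1/4}p; |U(A(⟨y,y′⟩))ψ(y′) − ψ(y)| ≤ |ψ(y′) − φ(y′)| +
Σ_{b⊂⟨y,y′⟩}|(D_Aφ)(b)| + |ψ(y) − φ(y)| ≤ Ldp + Lp + Ldp ≤ 3Ldp.  SIDE CONDITIONS OF THE PRINTED ARITHMETIC MADE EXPLICIT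
(standing in the paper for ε small; binders of the theorem, HOME/GAPS.md reading note): p(ε) ≥ 0; "λ(ε)^{−1/4}p + p ≤
2λ(ε)^{−1/4}p" and "p/(μ₀ε) + p ≤ 2p/(μ₀ε)" use 0 < λ(ε) ≤ 1, 0 < μ₀ε ≤ 1; 0 < K (so |B(y)| = L^d); d ≥ 1, L ≥ 1 are in `Params`.
Unit `lit-balaban-p17` (Phase-2 proof seat p17), HOME `run/shared/lean/pub/lit-balaban/` (PHASE2-TARGETS.md §G.3 line
p17; referee ref-4).  Value = one SKELETON row proved at the concrete model; NOT summit progress.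
-/

open scoped BigOperators
open Finset

namespace Literature.MathematicalPhysics.QuantumFieldTheory.Balaban1983to89.B2Restr216Concrete

open Literature.MathematicalPhysics.QuantumFieldTheory.Balaban1983to89.HiggsLattice
open Literature.MathematicalPhysics.QuantumFieldTheory.Balaban1983to89.HiggsAveraging
open Literature.MathematicalPhysics.QuantumFieldTheory.Balaban1983to89.B2Restr216Lattice

variable {P : Params}

/-! ## 1. The block of `y ∈ T′₁`: every staircase stays inside `B(y)`; the block average -/

section BlockEstimates

variable {N : ℕ}

/-- The transport `U(A(⟨y, y′⟩))`, `y′ = y + e_μ` in T′₁, of the third line of (2.16): the T′₁-bond is the straight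
contour of `L` bonds of T₁ from `y`, summed as in (I.2.3) (`HiggsAveraging.segSum`). [cite: Balaban1982Higgs2, (2.16) p.560] -/
noncomputable def bondHol (C : ChargeData N) (A : VecField P 0) (y : Site P 1) (μ : Fin P.d) :
    EuclideanSpace ℝ (Fin N) →L[ℝ] EuclideanSpace ℝ (Fin N) :=
  C.U (P.mesh 0) (segSum A (emb y) μ P.L)

/-- For `x ∈ B(y)` the number of steps of Γ_{y,x} in direction `μ` is `< L` ((I.1.17): `0 ≤ x_μ − y_μ ≤ L − 1`), and the
corner label is `≤` the label of `x`. [cite: Balaban1982Higgs1, (1.17) p.606] -/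
theorem steps_lt (hK : 0 < P.K) {y : Site P 1} {x : Site P 0} (hx : x ∈ block y) (μ : Fin P.d) :
    (emb y μ).val ≤ (x μ).val ∧ (x μ - emb y μ).val = (x μ).val - (y μ).val * P.L ∧
      (x μ - emb y μ).val < P.L := by
  rw [mem_block_iff hK] at hx
  have h1 : (y μ).val * P.L ≤ (x μ).val := by rw [← hx μ]; exact Nat.div_mul_le_self _ _
  have h2 : (x μ).val < ((y μ).val + 1) * P.L := by rw [← hx μ, ← Nat.div_lt_iff_lt_mul P.hL]; exact Nat.lt_succ_self _
  have hv : (emb y μ).val = (y μ).val * P.L := val_emb hK y μ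
  refine ⟨hv ▸ h1, ?_, ?_⟩
  · rw [ZMod.val_sub (hv ▸ h1), hv]
  · rw [ZMod.val_sub (hv ▸ h1), hv]
    rw [Nat.add_mul, one_mul] at h2
    omega

/-- A site of `B(y)` whose `μ`-th label is `nL + a`, moved `j` steps in direction `μ` with `a + j < L`, is still in `B(y)`.
[cite: Balaban1982Higgs1, (1.17) p.606] -/
theorem shiftN_mem_block (hK : 0 < P.K) {y : Site P 1} {z : Site P 0} (hz : z ∈ block y) (μ : Fin P.d) (j : ℕ)
    (hj : (z μ).val + j < ((y μ).val + 1) * P.L) : shiftN z μ j ∈ block y := by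
  have hz' := (mem_block_iff hK y z).mp hz μ
  have hlt : (z μ).val + j < P.sitesPerDir 0 μ := by
    have hy : (y μ).val + 1 ≤ P.sitesPerDir 1 μ := ZMod.val_lt (y μ)
    have h1 := Nat.mul_le_mul_right P.L hy
    have h2 := sitesPerDir_eq_mul hK μ
    rw [Nat.add_mul, one_mul] at h1
    linarith [mul_comm P.L (P.sitesPerDir (0 + 1) μ)]
  have hjlt : j < P.sitesPerDir 0 μ := lt_of_le_of_lt (Nat.le_add_left _ _) hlt
  refine update_mem_block hK hz μ _ ?_
  rw [ZMod.val_add_of_lt (by rwa [ZMod.val_cast_of_lt hjlt]), ZMod.val_cast_of_lt hjlt]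
  apply Nat.div_eq_of_lt_le
  · have := Nat.div_mul_le_self (z μ).val P.L
    rw [hz'] at this
    omega
  · exact hj

/-- Every corner of the staircase Γ_{y,x}, `x ∈ B(y)`, lies in `B(y)`. [cite: Balaban1982Higgs1, (2.1) p.608] -/
theorem cornerN_mem_block (hK : 0 < P.K) {y : Site P 1} {x : Site P 0} (hx : x ∈ block y) (t : ℕ) :
    cornerN (emb y) x t ∈ block y := by
  have hy := (mem_block_iff hK y (emb y)).mp (emb_mem_block hK y)
  rw [mem_block_iff hK] at hx ⊢
  intro μ
  simp only [cornerN]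
  split_ifs
  · exact hy μ
  · exact hx μ

/-- **p. 559**: `|U(A(Γ_{y,x}))φ(x) − φ(y)| ≤ Σ_{b⊂Γ_{y,x}}|(D_Aφ)(b)| ≤ (L − 1)dp` for `x ∈ B(y)`, when `|(D_Aφ)(b)| ≤ p` on the
bonds of T₁ inside `B(y)` (the staircase consists of `≤ (L − 1)d` such bonds). [cite: Balaban1982Higgs2, (2.16) p.559] -/
theorem norm_holQ_sub_le (hK : 0 < P.K) (C : ChargeData N) (A : VecField P 0) (φ : ScalarField P 0 N) {p : ℝ}
    (hp : 0 ≤ p) (y : Site P 1) {x : Site P 0} (hx : x ∈ block y)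
    (hD : ∀ b : PBond P 0, b.src ∈ block y → b.tgt ∈ block y → ‖covDiff C A φ b‖ ≤ p) :
    ‖holQ C A y x (φ x) - φ (emb y)‖ ≤ ((P.L : ℝ) - 1) * P.d * p := by
  have hcast : ((P.L - 1 : ℕ) : ℝ) = (P.L : ℝ) - 1 := by rw [Nat.cast_sub P.hL, Nat.cast_one]
  have h := norm_U_contourSum_cornerN_sub_le C A φ (emb y) x (m := P.L - 1) hp
    (fun t => by have := (steps_lt hK hx t).2.2; omega)
    (fun t j hj => by
      have hct : cornerN (emb y) x (t + 1) t = emb y t := by simp [cornerN]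
      have hst := steps_lt hK hx t
      have hc := cornerN_mem_block hK hx (t + 1)
      have hv : (cornerN (emb y) x (t + 1) t).val = (y t).val * P.L := by rw [hct, val_emb hK]
      have hjL : j + 1 < P.L := by omega
      refine hD _ ?_ ?_
      · exact shiftN_mem_block hK hc t j (by rw [hv, Nat.add_mul, one_mul]; omega)
      · show (shiftN (cornerN (emb y) x (↑t + 1)) t j).shift t ∈ block y
        rw [shiftN_succ]
        exact shiftN_mem_block hK hc t (j + 1) (by rw [hv, Nat.add_mul, one_mul]; omega))
    P.d le_rfl
  rw [cornerN_d, hcast] at h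
  have e : holQ C A y x (φ x) = C.U (P.mesh 0) (contourSum A (emb y) x) (φ x) := by
    rw [holQ, toFinest_one, toFinest_zero]; rfl
  rw [e]
  linarith [h]

/-- **p. 559**: `|(Q(A)φ)(y) − φ(y)| ≤ (L − 1)dp` — r14's averaging step `B2LargeField.norm_blockAvg_sub_le` over `B(y)`
(`|B(y)| = L^d`, `card_block`) applied to `norm_holQ_sub_le`. [cite: Balaban1982Higgs2, (2.16) p.559] -/
theorem norm_avgQ_sub_le (hK : 0 < P.K) (C : ChargeData N) (A : VecField P 0) (φ : ScalarField P 0 N) {p : ℝ}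
    (hp : 0 ≤ p) (y : Site P 1) (hD : ∀ b : PBond P 0, b.src ∈ block y → b.tgt ∈ block y → ‖covDiff C A φ b‖ ≤ p) :
    ‖avgQ C A φ y - φ (emb y)‖ ≤ ((P.L : ℝ) - 1) * P.d * p := by
  have h := B2LargeField.norm_blockAvg_sub_le (block y) ⟨emb y, emb_mem_block hK y⟩ (fun x => holQ C A y x (φ x))
    (φ (emb y)) (fun x hx => norm_holQ_sub_le hK C A φ hp y hx hD)
  have hc : ((block y).card : ℝ) = (P.L : ℝ) ^ P.d := by rw [card_block hK]; push_cast; rfl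
  rw [hc] at h
  exact h

/-- **(2.16) p. 559**: `|ψ(y) − φ(y)| ≤ Ldp` from `|ψ(y) − (Q(A)φ)(y)| ≤ p` and the previous estimate (r14's
`display216a`). [cite: Balaban1982Higgs2, (2.16) p.559] -/
theorem norm_psi_sub_phi_le (hK : 0 < P.K) (C : ChargeData N) (A : VecField P 0) (φ : ScalarField P 0 N)
    (ψ : ScalarField P 1 N) {p : ℝ} (hp : 0 ≤ p) (y : Site P 1) (h4 : ‖ψ y - avgQ C A φ y‖ ≤ p)
    (hD : ∀ b : PBond P 0, b.src ∈ block y → b.tgt ∈ block y → ‖covDiff C A φ b‖ ≤ p) :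
    ‖ψ y - φ (emb y)‖ ≤ P.L * P.d * p :=
  B2LargeField.display216a (by exact_mod_cast P.hd) hp h4 (norm_avgQ_sub_le hK C A φ hp y hD)

/-- **(2.16) line 1, p. 560**: `|ψ(y) − U(A(Γ_{y,x}))φ(x)| ≤ 2Ldp` for `x ∈ B(y)` (r14's `display216b`). [cite: Balaban1982Higgs2, (2.16) p.560] -/
theorem line216_transport (hK : 0 < P.K) (C : ChargeData N) (A : VecField P 0) (φ : ScalarField P 0 N)
    (ψ : ScalarField P 1 N) {p : ℝ} (hp : 0 ≤ p) (y : Site P 1) {x : Site P 0} (hx : x ∈ block y)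
    (h4 : ‖ψ y - avgQ C A φ y‖ ≤ p)
    (hD : ∀ b : PBond P 0, b.src ∈ block y → b.tgt ∈ block y → ‖covDiff C A φ b‖ ≤ p) :
    ‖ψ y - holQ C A y x (φ x)‖ ≤ 2 * P.L * P.d * p :=
  B2LargeField.display216b (Nat.cast_nonneg _) hp (norm_psi_sub_phi_le hK C A φ ψ hp y h4 hD)
    (norm_holQ_sub_le hK C A φ hp y hx hD)

/-- **(2.16) line 2, p. 559/560**: `|ψ(y)| ≤ |L^{−d}Σ_{x∈B(y)}U(A(Γ_{y,x}))φ(x)| + p ≤ L^{−d}Σ_{x∈B(y)}|φ(x)| + p ≤ p/t + p ≤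
2p/t` for the threshold `|φ(x)| ≤ p/t` on `B(y)`, `0 < t ≤ 1` (t = λ(ε)^{1/4}; the last step uses `t ≤ 1`).
[cite: Balaban1982Higgs2, (2.16) p.559] -/
theorem line216_abs (hK : 0 < P.K) (C : ChargeData N) (A : VecField P 0) (φ : ScalarField P 0 N)
    (ψ : ScalarField P 1 N) {p t : ℝ} (hp : 0 ≤ p) (ht : 0 < t) (ht1 : t ≤ 1) (y : Site P 1)
    (h4 : ‖ψ y - avgQ C A φ y‖ ≤ p) (h6 : ∀ x ∈ block y, ‖φ x‖ ≤ p / t) : ‖ψ y‖ ≤ 2 / t * p := by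
  have hLd : (0 : ℝ) < (P.L : ℝ) ^ P.d := pow_pos (by exact_mod_cast P.hL) _
  have havg : ‖avgQ C A φ y‖ ≤ p / t := by
    rw [avgQ_apply, norm_smul, Real.norm_of_nonneg (inv_nonneg.mpr hLd.le)]
    calc ((P.L : ℝ) ^ P.d)⁻¹ * ‖∑ x ∈ block y, C.U (P.mesh 0) (contourSum A (toFinest y) (toFinest x)) (φ x)‖
        ≤ ((P.L : ℝ) ^ P.d)⁻¹ * ∑ x ∈ block y, (p / t) := by
          gcongr
          refine (norm_sum_le _ _).trans (Finset.sum_le_sum fun x hx => ?_)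
          rw [norm_U_apply]
          exact h6 x hx
      _ = p / t := by
          rw [Finset.sum_const, card_block hK, nsmul_eq_mul]
          push_cast
          field_simp
  have hpt : p ≤ p / t := by
    rw [le_div_iff₀ ht]
    exact mul_le_of_le_one_right hp ht1
  calc ‖ψ y‖ = ‖(ψ y - avgQ C A φ y) + avgQ C A φ y‖ := by rw [sub_add_cancel]
    _ ≤ ‖ψ y - avgQ C A φ y‖ + ‖avgQ C A φ y‖ := norm_add_le _ _
    _ ≤ p + p / t := add_le_add h4 havg
    _ ≤ p / t + p / t := by linarith
    _ = 2 / t * p := by ring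

/-- The coarse bond `⟨y, y + e_μ⟩` of T′₁ ends, as a straight contour of `L` bonds of T₁ from `y`, at `y + e_μ`
((I.1.19): label `(n+1)L = nL + L`, including the wrap-around of the torus). [cite: Balaban1982Higgs1, (1.19) p.607] -/
theorem shiftN_emb (hK : 0 < P.K) (y : Site P 1) (μ : Fin P.d) : shiftN (emb y) μ P.L = emb (y.shift μ) := by
  funext ν
  by_cases hν : ν = μ
  · subst hν
    simp only [shiftN, Site.shift, Function.update_self, emb]
    have hy : (y ν + 1 : ZMod (P.sitesPerDir (0 + 1) ν)) = (((y ν).val + 1 : ℕ) : ZMod (P.sitesPerDir (0 + 1) ν)) := by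
      push_cast; rw [ZMod.natCast_zmod_val]
    rw [hy, ZMod.val_natCast, ← Nat.cast_add, ZMod.natCast_eq_natCast_iff', sitesPerDir_eq_mul hK ν,
      show (y ν).val * P.L + P.L = ((y ν).val + 1) * P.L by ring, mul_comm P.L,
      Nat.mul_mod_mul_right, Nat.mul_mod_mul_right, Nat.mod_mod]
  · simp [shiftN, Site.shift, emb, Function.update_of_ne hν]

/-- **(2.16) line 3, p. 560**: for a bond `⟨y, y′⟩` of T′₁, `|U(A(⟨y,y′⟩))ψ(y′) − ψ(y)| ≤ |ψ(y′) − φ(y′)| +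
Σ_{b⊂⟨y,y′⟩}|(D_Aφ)(b)| + |ψ(y) − φ(y)| ≤ Ldp + Lp + Ldp ≤ 3Ldp` (the straight contour has `L` bonds; d ≥ 1).  The covariant
derivative bound is assumed on the bonds with both endpoints in a set `S ⊇ B(y) ∪ B(y′)` of sites of T₁.
[cite: Balaban1982Higgs2, (2.16) p.560] -/
theorem line216_bond (hK : 0 < P.K) (C : ChargeData N) (A : VecField P 0) (φ : ScalarField P 0 N)
    (ψ : ScalarField P 1 N) {p : ℝ} (hp : 0 ≤ p) (y : Site P 1) (μ : Fin P.d) {S : Finset (Site P 0)}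
    (hS : block y ⊆ S) (hS' : block (y.shift μ) ⊆ S)
    (h4 : ‖ψ y - avgQ C A φ y‖ ≤ p) (h4' : ‖ψ (y.shift μ) - avgQ C A φ (y.shift μ)‖ ≤ p)
    (hD : ∀ b : PBond P 0, b.src ∈ S → b.tgt ∈ S → ‖covDiff C A φ b‖ ≤ p) :
    ‖bondHol C A y μ (ψ (y.shift μ)) - ψ y‖ ≤ 3 * P.L * P.d * p := by
  have hd : (1 : ℝ) ≤ P.d := by exact_mod_cast P.hd
  have hL : (0 : ℝ) ≤ P.L := Nat.cast_nonneg _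
  have h1 : ‖ψ (y.shift μ) - φ (emb (y.shift μ))‖ ≤ P.L * P.d * p :=
    norm_psi_sub_phi_le hK C A φ ψ hp (y.shift μ) h4' (fun b hs ht => hD b (hS' hs) (hS' ht))
  have h3 : ‖ψ y - φ (emb y)‖ ≤ P.L * P.d * p :=
    norm_psi_sub_phi_le hK C A φ ψ hp y h4 (fun b hs ht => hD b (hS hs) (hS ht))
  have hv : (emb y μ).val = (y μ).val * P.L := val_emb hK y μ
  have h2 : ‖C.U (P.mesh 0) (segSum A (emb y) μ P.L) (φ (emb (y.shift μ))) - φ (emb y)‖ ≤ P.L * p := by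
    rw [← shiftN_emb hK]
    refine norm_U_segSum_sub_le C A φ (emb y) μ P.L fun i hi => hD _ ?_ ?_
    · exact hS (shiftN_mem_block hK (emb_mem_block hK y) μ i (by rw [hv]; linarith))
    · show (shiftN (emb y) μ i).shift μ ∈ S
      rw [shiftN_succ]
      rcases Nat.lt_or_ge (i + 1) P.L with h | h
      · exact hS (shiftN_mem_block hK (emb_mem_block hK y) μ (i + 1) (by rw [hv]; linarith))
      · have : i + 1 = P.L := le_antisymm hi h
        rw [this, shiftN_emb hK]
        exact hS' (emb_mem_block hK _)
  have key : bondHol C A y μ (ψ (y.shift μ)) - ψ y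
      = C.U (P.mesh 0) (segSum A (emb y) μ P.L) (ψ (y.shift μ) - φ (emb (y.shift μ)))
        + (C.U (P.mesh 0) (segSum A (emb y) μ P.L) (φ (emb (y.shift μ))) - φ (emb y))
        + (φ (emb y) - ψ y) := by
    rw [bondHol, map_sub]; abel
  have hLp : (P.L : ℝ) * p ≤ P.L * P.d * p := by
    have := mul_le_mul_of_nonneg_left hd (mul_nonneg hL hp)
    linarith [this]
  rw [key]
  refine (norm_add₃_le).trans ?_
  rw [norm_U_apply, norm_sub_rev (φ (emb y))]
  linarith [h1, h2, h3, hLp]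

end BlockEstimates

/-! ## 2. Vector fields: the same engine with N = d and external field 0 (I p. 608) -/

section VectorFields

variable {M : ℕ}

/-- A vector field as an ℝ^d-valued site function, `A(x) = (A_μ(x))_μ`, `A_μ(x) = A_{⟨x, x + e_μ⟩}` (I p. 604; the `|A(x)|`,
`(QA)(y)`, `(∂A)(b)` of (2.1)–(2.2) refer to this function). [cite: Balaban1982Higgs2, (2.1) p.556] -/
def vecAt {k : ℕ} (X : VecField P k) : ScalarField P k P.d := fun x => WithLp.toLp 2 fun μ => X.comp μ x

/-- The plain block average `(Qf)(y) = L^{−d} Σ_{x ∈ B(y)} f(x)` of (2.1)/(I.3.7) — `Q = Q(0)` (I p. 608: *"taking N = d and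
an external vector field A = 0"*; `avgQ_zeroField`), the tree's `B1.blockAvg` with identity transports. [cite: Balaban1982Higgs2, (2.1) p.556] -/
noncomputable def avgPlain (f : ScalarField P 0 M) : ScalarField P 1 M :=
  B1.blockAvg (((P.L : ℝ) ^ P.d)⁻¹) block (fun _ _ => LinearMap.id) f

/-- The charge data used to run the scalar engine on vector fields: external field `0` makes the coupling irrelevant;
we take `q = 0`. [cite: Balaban1982Higgs1, (2.7) p.608] -/
noncomputable def zeroCharge (M : ℕ) : ChargeData M :=
  ⟨0, 0, by rw [ContinuousLinearMap.star_eq_adjoint, map_zero, neg_zero], by simp⟩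

/-- At external field `0`: `(D_0 f)(b) = f(b₊) − f(b₋)` (the unit difference derivative). [cite: Balaban1982Higgs2, (2.1) p.556] -/
theorem covDiff_zeroField (C : ChargeData M) (f : ScalarField P 0 M) (b : PBond P 0) :
    covDiff C (0 : VecField P 0) f b = f b.tgt - f b.src := by
  simp [covDiff, ChargeData.U_zero]

/-- At external field `0` the transports along the staircases are the identity. [cite: Balaban1982Higgs1, (2.7) p.608] -/
theorem holQ_zeroField (C : ChargeData M) (y : Site P 1) (x : Site P 0) (v : EuclideanSpace ℝ (Fin M)) :
    holQ C (0 : VecField P 0) y x v = v := by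
  simp [holQ, contourSum, segSum, ChargeData.U_zero]

/-- At external field `0` the transport along a T′₁-bond is the identity. [cite: Balaban1982Higgs2, (2.17) p.560] -/
theorem bondHol_zeroField (C : ChargeData M) (y : Site P 1) (μ : Fin P.d) (v : EuclideanSpace ℝ (Fin M)) :
    bondHol C (0 : VecField P 0) y μ v = v := by
  simp [bondHol, segSum, ChargeData.U_zero]

/-- I p. 608 made formal: `Q(0) = Q`, the plain block average. [cite: Balaban1982Higgs1, (2.7) p.608] -/
theorem avgQ_zeroField (C : ChargeData M) (f : ScalarField P 0 M) : avgQ C (0 : VecField P 0) f = avgPlain f := by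
  funext y
  simp only [avgQ, avgPlain, B1.blockAvg, LinearMap.id_apply]
  congr 1
  exact Finset.sum_congr rfl fun x _ => holQ_zeroField C y x (f x)

/-- **(2.17) line 1, p. 560**: `|B(y) − A(x)| ≤ 2Ldp` for `x ∈ B(y)` — (2.16) line 1 at N = d, external field 0.
[cite: Balaban1982Higgs2, (2.17) p.560] -/
theorem line217_transport (hK : 0 < P.K) (A : VecField P 0) (B : VecField P 1) {p : ℝ} (hp : 0 ≤ p) (y : Site P 1)
    {x : Site P 0} (hx : x ∈ block y) (h1 : ‖vecAt B y - avgPlain (vecAt A) y‖ ≤ p)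
    (hD : ∀ b : PBond P 0, b.src ∈ block y → b.tgt ∈ block y → ‖vecAt A b.tgt - vecAt A b.src‖ ≤ p) :
    ‖vecAt B y - vecAt A x‖ ≤ 2 * P.L * P.d * p := by
  have h := line216_transport hK (zeroCharge P.d) 0 (vecAt A) (vecAt B) hp y hx (by rwa [avgQ_zeroField])
    (fun b hs ht => by rw [covDiff_zeroField]; exact hD b hs ht)
  rwa [holQ_zeroField] at h

/-- **(2.17) line 2, p. 560**: `|B(y)| ≤ |(QA)(y)| + p ≤ p/(μ₀ε) + p ≤ (2/(μ₀ε))p` (the last step uses `μ₀ε ≤ 1`) — (2.16)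
line 2 at N = d, external field 0, threshold `t = μ₀ε`. [cite: Balaban1982Higgs2, (2.17) p.560] -/
theorem line217_abs (hK : 0 < P.K) (A : VecField P 0) (B : VecField P 1) {p t : ℝ} (hp : 0 ≤ p) (ht : 0 < t)
    (ht1 : t ≤ 1) (y : Site P 1) (h1 : ‖vecAt B y - avgPlain (vecAt A) y‖ ≤ p)
    (h3 : ∀ x ∈ block y, ‖vecAt A x‖ ≤ p / t) : ‖vecAt B y‖ ≤ 2 / t * p :=
  line216_abs hK (zeroCharge P.d) 0 (vecAt A) (vecAt B) hp ht ht1 y (by rwa [avgQ_zeroField]) h3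

/-- **(2.17) line 3, p. 560**: `|B(y) − B(y′)| ≤ 3Ldp` for a bond `⟨y, y′⟩` of T′₁ — (2.16) line 3 at N = d, external
field 0. [cite: Balaban1982Higgs2, (2.17) p.560] -/
theorem line217_bond (hK : 0 < P.K) (A : VecField P 0) (B : VecField P 1) {p : ℝ} (hp : 0 ≤ p) (y : Site P 1)
    (μ : Fin P.d) {S : Finset (Site P 0)} (hS : block y ⊆ S) (hS' : block (y.shift μ) ⊆ S)
    (h1 : ‖vecAt B y - avgPlain (vecAt A) y‖ ≤ p) (h1' : ‖vecAt B (y.shift μ) - avgPlain (vecAt A) (y.shift μ)‖ ≤ p)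
    (hD : ∀ b : PBond P 0, b.src ∈ S → b.tgt ∈ S → ‖vecAt A b.tgt - vecAt A b.src‖ ≤ p) :
    ‖vecAt B y - vecAt B (y.shift μ)‖ ≤ 3 * P.L * P.d * p := by
  have h := line216_bond hK (zeroCharge P.d) 0 (vecAt A) (vecAt B) hp y μ hS hS' (by rwa [avgQ_zeroField])
    (by rwa [avgQ_zeroField]) (fun b hs ht => by rw [covDiff_zeroField]; exact hD b hs ht)
  rwa [bondHol_zeroField, norm_sub_rev] at h

end VectorFields

/-! ## 3. The model instance of `R216Setting` and the proof of (2.16)–(2.17) for it -/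

section Instance

variable {N : ℕ}

/-- THE CONCRETE INSTANCE of r02's carrier `B2Sect2Statements.R216Setting` for the first step (Sect. 2.A): fields `A`
(bonds of T₁ = `Site P 0`), `φ : T₁ → R^N`, block fields `B` (bonds of T′₁ = `Site P 1`), `ψ : T′₁ → R^N`, the region
Λ = Λ′₋₁ ⊂ T′₁ (blocks; points B(Λ) = `blockSet Λ`, bonds of T₁ with both endpoints in B(Λ), bonds ⟨y, y + e_μ⟩ of T′₁
with both endpoints in Λ), `p` ↤ p(ε), `lam` ↤ λ(ε) = λε^{4−d}, `mu0s` ↤ μ₀ε; `restrSmall` = the small-field restrictions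
(negations of (2.2) p. 557) on the region: |B(y) − (QA)(y)| ≤ p, |(∂A)(b)| ≤ p, |A(x)| ≤ p/(μ₀ε), |ψ(y) − (Q(A)φ)(y)| ≤ p,
|(D_Aφ)(b)| ≤ p, |φ(x)| ≤ p/λ(ε)^{1/4}; the six suprema of (2.16)/(2.17) over x ∈ B(y), y ∈ Λ′₋₁, ⟨y, y′⟩ ∈ Λ′*₋₁.
[cite: Balaban1982Higgs2, (2.16)–(2.17) p.560] -/
noncomputable def setting216 (C : ChargeData N) (A : VecField P 0) (φ : ScalarField P 0 N) (ψ : ScalarField P 1 N)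
    (B : VecField P 1) (Λ : Finset (Site P 1)) (p lam mu0s : ℝ) : B2Sect2Statements.R216Setting where
  p := p
  L := P.L
  d := P.d
  lam := lam
  mu0s := mu0s
  restrSmall :=
    (∀ y ∈ Λ, ‖vecAt B y - avgPlain (vecAt A) y‖ ≤ p) ∧
    (∀ b : PBond P 0, b.src ∈ blockSet Λ → b.tgt ∈ blockSet Λ → ‖vecAt A b.tgt - vecAt A b.src‖ ≤ p) ∧
    (∀ x ∈ blockSet Λ, ‖vecAt A x‖ ≤ p / mu0s) ∧
    (∀ y ∈ Λ, ‖ψ y - avgQ C A φ y‖ ≤ p) ∧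
    (∀ b : PBond P 0, b.src ∈ blockSet Λ → b.tgt ∈ blockSet Λ → ‖covDiff C A φ b‖ ≤ p) ∧
    (∀ x ∈ blockSet Λ, ‖φ x‖ ≤ p / lam ^ (1 / 4 : ℝ))
  supψUφ := ⨆ q : {q : Site P 1 × Site P 0 // q.1 ∈ Λ ∧ q.2 ∈ block q.1}, ‖ψ q.1.1 - holQ C A q.1.1 q.1.2 (φ q.1.2)‖
  supψ := ⨆ y : Λ, ‖ψ y‖
  supUψψ := ⨆ q : {q : Site P 1 × Fin P.d // q.1 ∈ Λ ∧ q.1.shift q.2 ∈ Λ},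
    ‖bondHol C A q.1.1 q.1.2 (ψ (q.1.1.shift q.1.2)) - ψ q.1.1‖
  supBA := ⨆ q : {q : Site P 1 × Site P 0 // q.1 ∈ Λ ∧ q.2 ∈ block q.1}, ‖vecAt B q.1.1 - vecAt A q.1.2‖
  supB := ⨆ y : Λ, ‖vecAt B y‖
  supBB := ⨆ q : {q : Site P 1 × Fin P.d // q.1 ∈ Λ ∧ q.1.shift q.2 ∈ Λ}, ‖vecAt B q.1.1 - vecAt B (q.1.1.shift q.1.2)‖

/-- **(2.16)–(2.17) p. 560 PROVED for the concrete model** (`setting216`): under the small-field restrictions on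
Λ^{(*,′)}₋₁, `|ψ(y) − U(A(Γ_{y,x}))φ(x)| ≤ 2Ldp(ε)` (x ∈ B(y)), `|ψ(y)| ≤ (2/λ(ε)^{1/4})p(ε)` (y ∈ Λ′₋₁),
`|U(A(⟨y,y′⟩))ψ(y′) − ψ(y)| ≤ 3Ldp(ε)` (⟨y,y′⟩ ∈ Λ′*₋₁), `|B(y) − A(x)| ≤ 2Ldp(ε)`, `|B(y)| ≤ (2/(μ₀ε))p(ε)`,
`|B(y) − B(y′)| ≤ 3Ldp(ε)` — in the parameter range where the printed arithmetic holds: p(ε) ≥ 0, 0 < λ(ε) ≤ 1,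
0 < μ₀ε ≤ 1, and K > 0. [cite: Balaban1982Higgs2, (2.16)–(2.17) p.560] -/
theorem restr216Printed_setting216 (hK : 0 < P.K) (C : ChargeData N) (A : VecField P 0) (φ : ScalarField P 0 N)
    (ψ : ScalarField P 1 N) (B : VecField P 1) (Λ : Finset (Site P 1)) {p lam mu0s : ℝ} (hp : 0 ≤ p)
    (hlam : 0 < lam) (hlam1 : lam ≤ 1) (hmu : 0 < mu0s) (hmu1 : mu0s ≤ 1) :
    B2Sect2Statements.Restr216Printed (setting216 C A φ ψ B Λ p lam mu0s) := by
  rintro ⟨hR1, hR2, hR3, hR4, hR5, hR6⟩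
  have hL : (0 : ℝ) ≤ P.L := Nat.cast_nonneg _
  have hd : (0 : ℝ) ≤ P.d := Nat.cast_nonneg _
  have ht : 0 < lam ^ (1 / 4 : ℝ) := Real.rpow_pos_of_pos hlam _
  have ht1 : lam ^ (1 / 4 : ℝ) ≤ 1 := Real.rpow_le_one hlam.le hlam1 (by norm_num)
  -- restrictions localised to one block
  have hD : ∀ y ∈ Λ, ∀ b : PBond P 0, b.src ∈ block y → b.tgt ∈ block y → ‖covDiff C A φ b‖ ≤ p :=
    fun y hy b hs ht' => hR5 b (mem_blockSet_of_mem_block hy hs) (mem_blockSet_of_mem_block hy ht')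
  have hDv : ∀ y ∈ Λ, ∀ b : PBond P 0, b.src ∈ block y → b.tgt ∈ block y → ‖vecAt A b.tgt - vecAt A b.src‖ ≤ p :=
    fun y hy b hs ht' => hR2 b (mem_blockSet_of_mem_block hy hs) (mem_blockSet_of_mem_block hy ht')
  have hsub : ∀ y ∈ Λ, block y ⊆ blockSet Λ := fun y hy x hx => mem_blockSet_of_mem_block hy hx
  refine ⟨?_, ?_, ?_, ?_, ?_, ?_⟩
  · refine Real.iSup_le (fun q => ?_) (by positivity)
    obtain ⟨⟨y, x⟩, hy, hx⟩ := q
    exact line216_transport hK C A φ ψ hp y hx (hR4 y hy) (hD y hy)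
  · refine Real.iSup_le (fun y => ?_) (by positivity)
    exact line216_abs hK C A φ ψ hp ht ht1 y (hR4 y y.2) (fun x hx => hR6 x (hsub y y.2 hx))
  · refine Real.iSup_le (fun q => ?_) (by positivity)
    obtain ⟨⟨y, μ⟩, hy, hy'⟩ := q
    exact line216_bond hK C A φ ψ hp y μ (hsub y hy) (hsub _ hy') (hR4 y hy) (hR4 _ hy') hR5
  · refine Real.iSup_le (fun q => ?_) (by positivity)
    obtain ⟨⟨y, x⟩, hy, hx⟩ := q
    exact line217_transport hK A B hp y hx (hR1 y hy) (hDv y hy)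
  · refine Real.iSup_le (fun y => ?_) (by positivity)
    exact line217_abs hK A B hp hmu hmu1 y (hR1 y y.2) (fun x hx => hR3 x (hsub y y.2 hx))
  · refine Real.iSup_le (fun q => ?_) (by positivity)
    obtain ⟨⟨y, μ⟩, hy, hy'⟩ := q
    exact line217_bond hK A B hp y μ (hsub y hy) (hsub _ hy') (hR1 y hy) (hR1 _ hy') hR2

end Instance

end Literature.MathematicalPhysics.QuantumFieldTheory.Balaban1983to89.B2Restr216Concrete
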